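import Summits.HodgeConjecture.CorCM.B01.Transposition.Item6CentralTypeAtPinIndex
import Literature.NumberTheory.Weil1964.AdelicSchrodingerConjCont
import HarnessLib

/-!
# X3-Char at the COR-CM pin under COMPLEX CONJUGATION: the central type flips sign (Track T, item (T4d))

Cell pub-hodgecm2 (COR-CM), seat pin-3 (gen 13), 2026-08-24.  Sequel of ✔ `Transposition/Item6CentralTypeAtPin[Index]`
(p370826 ∕ p371055).  Track T (own-crow PROPOSAL T; ω-side spec mc-theta-3 HOME/INBOX l.12038; route `d2bridge-htheta-1`) transports
the Weil module of an index line at the Gram scalar `a` to the CONJUGATE module at the mirror scalar `a' = −a` along complex conjugation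
`C = piSchwartzBruhatConj` of `𝒮(𝔸³)` ((T4a)(T4b) ✔ p372832 `Weil1964/AdelicMetaplecticFinRepConj`, (T4c) ✔ p372913 ∕ ✔ p373037).
Item (T4d) is the INDEX READING of the transported pair splitting `s'`; this file supplies it in the package currency
`HodgeCM.Model.LiuIndex.HasCentralTypeAt V a s m` (port layer L69) and Liu's table `LiuIndex.muLiu` (L72):

* §1 `starRingEnd_archWeight` — `conj (archWeight L m t) = archWeight L (−m) t` (unitary characters);
* §2 the pin's Gaussian under conjugation and under `a ↦ −a`: `gaussianAt_eq_of_val_eq_neg` (the scaled Folland frame of the pin sees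
  the line scalar only through `√|x_W|`), `conj_gaussianAt_apply` ∕ `schwartzConj_gaussianAt` (the Folland–Fock vacuum is real-valued),
  `piSchwartzBruhatConj_testFun` ∕ `piSchwartzBruhatConj_testFun_gaussianAt` (the thin-coset test functions `h₀ ⊗ 𝟙_{coset}` of the
  mirror line are the conjugates of those of the line);
* §3 **`hasCentralTypeAt_neg_of_conj[_of_val_eq_neg]`** — BINDER-SHAPED FLIP: if the pair representation of `s'` at `a'` is the
  `C`-conjugate of that of `s` at `a` on the centre elements `(t · 1_V, 1)` and the Gaussian test functions (the operator law (T4b″) of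
  the conjugate splitting, taken as a HYPOTHESIS — nothing of p372832 ∕ p372913 ∕ p373037 is restated), then
  `HasCentralTypeAt V a s m → HasCentralTypeAt V a' s' (−m)`;
* §4 the reading in Liu's table: `mem_lineType_iff_not_mem_of_val_eq_neg` (`τ ∈ Φ^δ(−a) ↔ τ ∉ Φ^δ(a)`; type-level form = wb-1's ✔
  `D2Bridge/LineTypeConj.bar_lineType`), `muLiu_mk_eq_neg_of_val_eq_neg` (`muLiu ι₁ ρ (mk a') = − muLiu ι₁ ρ (mk a)`),
  `muLiu_mk_eq_centralType_weightOneType_lineType`, and **`exists_weightOne_eq_chiSplittingLine_toHeckeCharacter_of_conj[_muLiu ∕ _line]`**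
  — a CONTINUOUS compatible conjugate partner `s'` at `−a` of an index-typed splitting `s` at `a` IS `ι_{toHecke μ′}` for some `μ′`
  conjugate symplectic OF WEIGHT ONE with `Φ_{μ′} = Φ^δ(−a) = Φ̄^δ(a)`, and has Liu's central type `muLiu ι₁ ρ (mk (−a))` of the MIRROR
  class — (T4d) as countersigned HOME/INBOX l.12057 (i): `s'` is an honest member of the index family `I V ρ (muLiu ι₁ ρ)` at `mk (−a)`.

KERNEL only (theorems).  HC_CM is NOT proved here or anywhere; «Δ2 BRIDGE CLOSED» is NOT claimed; nothing here inhabits `hLiu ∕ hM ∕ hΘ′`;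
no pointer moves.
-/

set_option autoImplicit false

noncomputable section

namespace Summit.HodgeConjecture.CorCM.Transposition.CentralTypeAtPin

open NumberField NumberField.InfinitePlace NumberField.ComplexEmbedding NumberField.mixedEmbedding IsDedekindDomain
open scoped Matrix SchwartzMap Classical TensorProduct ComplexConjugate
open Literature.NumberTheory.Automorphic Literature.NumberTheory.Automorphic.UnitaryGroup Literature.NumberTheory.Weil1964
open Literature.NumberTheory.GelbartRogawski1991 Literature.NumberTheory.GelbartRogawski1991.UnitaryDualPair
open Literature.NumberTheory.GelbartRogawski1991.GRConstruction
open Literature.NumberTheory.Automorphic.Liu2021.Def411WeilCarriersDoubling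
open Literature.NumberTheory.Automorphic.IdeleClassGroup
open Literature.NumberTheory.GaloisRepresentations
open Literature.RepresentationTheory.HarrisKudlaSweet1996
open Literature.Analysis.SegalBargmann
open HodgeCM HodgeCM.Model HodgeCM.Model.LiuIndex
open HodgeCM.SignRecipe (lineType mem_lineType_iff eta_eq_imagUnit)
open HodgeCM.Model.ArchSideTerm (e₁)
open HodgeCM.Model.SupplyInstance (testFun finEmb coe_testFun)

/-! ## §1 Unitary archimedean weights under conjugation -/

section ArchWeight

variable (L : Type) [Field L] [NumberField L] [IsCMField L]

/-- **`conj (archWeight L m t) = archWeight L (−m) t`**: the typed archimedean weight is a unitary character, so its complex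
conjugate is its inverse, the weight of the negated type. [folklore] -/
theorem starRingEnd_archWeight (m : InfinitePlace L → ℤ)
    (t : ↥(Literature.NumberTheory.Automorphic.relNormOneInfUnits (↥(maximalRealSubfield L)) L)) :
    starRingEnd ℂ (Literature.NumberTheory.Automorphic.archWeight L m t) = Literature.NumberTheory.Automorphic.archWeight L (-m) t := by
  have h1 : Literature.NumberTheory.Automorphic.archWeight L m t * Literature.NumberTheory.Automorphic.archWeight L (-m) t = 1 := by
    rw [← Literature.NumberTheory.Automorphic.archWeight_add, add_neg_cancel, Literature.NumberTheory.Automorphic.archWeight_zero]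
  rw [← Complex.inv_eq_conj (Literature.NumberTheory.Automorphic.norm_archWeight L m t)]
  exact (eq_inv_of_mul_eq_one_right h1).symm

end ArchWeight

/-! ## §2 The pin's Gaussian under conjugation and under `a ↦ −a` -/

section Gaussian

variable {L : CMField} {ι₁ : (L : Type) →+* ℂ} (V : HermSpace3 L ι₁)

/-- the `W`-scalings `√|x_W|` of the pin's canonical frame do not see the sign of the line scalar. [folklore] -/
theorem cmDW_eq_of_val_eq_neg (a a' : RealScalar L) (ha' : a'.1 = -a.1) :
    HypCensus.cmDW (L : Type) (frameD V) (RealScalar.vec a') (RealScalar.vec_real a') ι₁ =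
      HypCensus.cmDW (L : Type) (frameD V) (RealScalar.vec a) (RealScalar.vec_real a) ι₁ := by
  funext v j
  have hneg : cmRealVec (L : Type) (RealScalar.vec a') (RealScalar.vec_real a') j =
      -cmRealVec (L : Type) (RealScalar.vec a) (RealScalar.vec_real a) j :=
    Subtype.ext ha'
  simp only [HypCensus.cmDW, HypCensus.cmXW, sqrtAbs, placeSignVec, hneg, map_neg, neg_div, abs_neg]

/-- **`gaussianAt V a' = gaussianAt V a` for `a' = −a`**: the pin's scaled Folland frame at `ι₁`, hence its Folland–Fock vacuum,
depends on the line scalar only through `√|x_W|`. [folklore] -/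
theorem gaussianAt_eq_of_val_eq_neg (a a' : RealScalar L) (ha' : a'.1 = -a.1) : gaussianAt V a' = gaussianAt V a := by
  have hD := cmDW_eq_of_val_eq_neg V a a' ha'
  have key : ∀ (D D' : Fin 3 × {v : InfinitePlace ↥(maximalRealSubfield (L : Type)) // v.IsReal} → ℝ)
      (hD0 : ∀ k, D k ≠ 0) (hD0' : ∀ k, D' k ≠ 0), D = D' →
      scaledFrame (↥(maximalRealSubfield (L : Type))) (Fin 3) D hD0 = scaledFrame (↥(maximalRealSubfield (L : Type))) (Fin 3) D' hD0' := by
    rintro D D' hD0 hD0' rfl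
    rfl
  rw [gaussianAt_def, gaussianAt_def]
  exact congrArg (fun 𝔢 => follandFock 𝔢 (1 : MvPolynomial _ ℂ)) (key _ _ _ _ (by rw [hD]))

/-- **the pin's Gaussian is REAL-VALUED**: `conj (gaussianAt V a y) = gaussianAt V a y` (`h₀(x) = 2^{n/4} e^{−π|x|²}` in the frame).
[folklore] -/
theorem conj_gaussianAt_apply (a : RealScalar L) (y : Fin 3 → mixedSpace ↥(maximalRealSubfield (L : Type))) :
    starRingEnd ℂ (gaussianAt V a y) = gaussianAt V a y := by
  rw [gaussianAt_def]
  simp only [follandFock, schwartzTransport_symm_apply, binvPi, binv_one, hermiteSchwartzPi_apply, hermiteFun, vac,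
    MvPolynomial.eval_C, gauss, map_mul, Complex.conj_ofReal, ← Complex.exp_conj, map_neg, map_sum, map_pow]

/-- `schwartzConj (gaussianAt V a) = gaussianAt V a`. [folklore] -/
theorem schwartzConj_gaussianAt (a : RealScalar L) : schwartzConj (gaussianAt V a) = gaussianAt V a := by
  ext y
  rw [schwartzConj_apply, conj_gaussianAt_apply]

/-- **`C (φ_∞ ⊗ 𝟙_{x₀ + N𝒪̂^J}) = φ̄_∞ ⊗ 𝟙_{x₀ + N𝒪̂^J}`**: conjugating a thin-coset test function conjugates its archimedean factor.
[folklore] -/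
theorem piSchwartzBruhatConj_testFun {K : Type} [Field K] [NumberField K] {J : Type} [Fintype J]
    (Φ : 𝓢((J → mixedSpace K), ℂ)) (x₀ : J → K) (N : ℕ) :
    piSchwartzBruhatConj K J (testFun K J Φ x₀ N) = testFun K J (schwartzConj Φ) x₀ N := by
  apply Subtype.ext
  rw [coe_piSchwartzBruhatConj, coe_testFun, coe_testFun]
  funext v
  rw [Pi.star_apply, thinCosetTestFun_apply, thinCosetTestFun_apply]
  split_ifs with h
  · rw [schwartzConj_apply, Complex.star_def]
  · exact star_zero ℂ

/-- **the test functions of the mirror line are the conjugates of those of the line**: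
`C (testFun (gaussianAt V a) x₀ N) = testFun (gaussianAt V a') x₀ N` for `a' = −a`. [folklore] -/
theorem piSchwartzBruhatConj_testFun_gaussianAt (a a' : RealScalar L) (ha' : a'.1 = -a.1)
    (x₀ : Fin 3 → ↥(maximalRealSubfield (L : Type))) (N : ℕ) :
    piSchwartzBruhatConj (↥(maximalRealSubfield (L : Type))) (Fin 3)
        (testFun (↥(maximalRealSubfield (L : Type))) (Fin 3) (gaussianAt V a) x₀ N) =
      testFun (↥(maximalRealSubfield (L : Type))) (Fin 3) (gaussianAt V a') x₀ N := by
  rw [piSchwartzBruhatConj_testFun, schwartzConj_gaussianAt, gaussianAt_eq_of_val_eq_neg V a a' ha']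

end Gaussian

/-! ## §3 The central type flips sign under a conjugate-linear intertwiner (binder-shaped) -/

section Flip

variable {L : CMField} {ι₁ : (L : Type) →+* ℂ} (V : HermSpace3 L ι₁)

/-- **THE FLIP, binder-shaped.**  Let `s` be a pair splitting at the scalar `a` and `s'` one at `a'`; suppose the thin-coset test
functions of the two Gaussians are `C`-conjugate (`hG`; discharged for `a' = −a` by `piSchwartzBruhatConj_testFun_gaussianAt`) and that
ON THEM the centre `(t · 1_V, 1)` acts through `ω_ψ ∘ s'` as the `C`-conjugate of its action through `ω_ψ ∘ s` (`hconj` — the operator law of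
the conjugate splitting `s' = s̄`, [Liu21, Lem. D.1 (2)] ∕ (T4b″), a HYPOTHESIS here).  Then a central type `m` of `s` gives the central
type `−m` of `s'`: `conj (ι_w(t)^{m_w}) = ι_w(t)^{−m_w}`. [folklore] -/
theorem hasCentralTypeAt_neg_of_conj {a a' : RealScalar L} {s : SplittingAt V a} {s' : SplittingAt V a'}
    {m : InfinitePlace (L : Type) → ℤ}
    (hG : ∀ (x₀ : Fin 3 → ↥(maximalRealSubfield (L : Type))) (N : ℕ),
      piSchwartzBruhatConj (↥(maximalRealSubfield (L : Type))) (Fin 3)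
          (testFun (↥(maximalRealSubfield (L : Type))) (Fin 3) (gaussianAt V a) x₀ N) =
        testFun (↥(maximalRealSubfield (L : Type))) (Fin 3) (gaussianAt V a') x₀ N)
    (hconj : ∀ (t : ↥(Literature.NumberTheory.Automorphic.relNormOneInfUnits (↥(maximalRealSubfield (L : Type))) (L : Type)))
      (x₀ : Fin 3 → ↥(maximalRealSubfield (L : Type))) (N : ℕ),
      pairRep (↥(maximalRealSubfield (L : Type))) (L : Type) (IsCMField.complexConj (L : Type)) 3 1 e₁ (Matrix.diagonal (frameD V))
          (Matrix.diagonal (RealScalar.vec a')) s'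
          (CMCenter (L : Type) (frameD V)
            ((cmAdelicOneEquivRelNormOne (L : Type)).symm
              (Literature.NumberTheory.Automorphic.relNormOneInfToIdeles (↥(maximalRealSubfield (L : Type))) (L : Type) t)), 1)
          (testFun (↥(maximalRealSubfield (L : Type))) (Fin 3) (gaussianAt V a') x₀ N) =
        piSchwartzBruhatConj (↥(maximalRealSubfield (L : Type))) (Fin 3)
          (pairRep (↥(maximalRealSubfield (L : Type))) (L : Type) (IsCMField.complexConj (L : Type)) 3 1 e₁ (Matrix.diagonal (frameD V))
            (Matrix.diagonal (RealScalar.vec a)) s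
            (CMCenter (L : Type) (frameD V)
              ((cmAdelicOneEquivRelNormOne (L : Type)).symm
                (Literature.NumberTheory.Automorphic.relNormOneInfToIdeles (↥(maximalRealSubfield (L : Type))) (L : Type) t)), 1)
            (piSchwartzBruhatConj (↥(maximalRealSubfield (L : Type))) (Fin 3)
              (testFun (↥(maximalRealSubfield (L : Type))) (Fin 3) (gaussianAt V a') x₀ N))))
    (h : HasCentralTypeAt V a s m) : HasCentralTypeAt V a' s' (-m) := by
  intro t x₀ N
  have hG' : piSchwartzBruhatConj (↥(maximalRealSubfield (L : Type))) (Fin 3)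
        (testFun (↥(maximalRealSubfield (L : Type))) (Fin 3) (gaussianAt V a') x₀ N) =
      testFun (↥(maximalRealSubfield (L : Type))) (Fin 3) (gaussianAt V a) x₀ N := by
    rw [← hG x₀ N, piSchwartzBruhatConj_piSchwartzBruhatConj]
  rw [hconj t x₀ N, hG', h t x₀ N, LinearEquiv.map_smulₛₗ, starRingEnd_archWeight, hG]

/-- **THE FLIP at the mirror scalar `a' = −a`**: the Gaussian hypothesis discharged (`piSchwartzBruhatConj_testFun_gaussianAt`); only the
operator law `hconj` of the conjugate splitting remains displayed. [folklore] -/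
theorem hasCentralTypeAt_neg_of_conj_of_val_eq_neg {a a' : RealScalar L} (ha' : a'.1 = -a.1) {s : SplittingAt V a}
    {s' : SplittingAt V a'} {m : InfinitePlace (L : Type) → ℤ}
    (hconj : ∀ (t : ↥(Literature.NumberTheory.Automorphic.relNormOneInfUnits (↥(maximalRealSubfield (L : Type))) (L : Type)))
      (x₀ : Fin 3 → ↥(maximalRealSubfield (L : Type))) (N : ℕ),
      pairRep (↥(maximalRealSubfield (L : Type))) (L : Type) (IsCMField.complexConj (L : Type)) 3 1 e₁ (Matrix.diagonal (frameD V))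
          (Matrix.diagonal (RealScalar.vec a')) s'
          (CMCenter (L : Type) (frameD V)
            ((cmAdelicOneEquivRelNormOne (L : Type)).symm
              (Literature.NumberTheory.Automorphic.relNormOneInfToIdeles (↥(maximalRealSubfield (L : Type))) (L : Type) t)), 1)
          (testFun (↥(maximalRealSubfield (L : Type))) (Fin 3) (gaussianAt V a') x₀ N) =
        piSchwartzBruhatConj (↥(maximalRealSubfield (L : Type))) (Fin 3)
          (pairRep (↥(maximalRealSubfield (L : Type))) (L : Type) (IsCMField.complexConj (L : Type)) 3 1 e₁ (Matrix.diagonal (frameD V))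
            (Matrix.diagonal (RealScalar.vec a)) s
            (CMCenter (L : Type) (frameD V)
              ((cmAdelicOneEquivRelNormOne (L : Type)).symm
                (Literature.NumberTheory.Automorphic.relNormOneInfToIdeles (↥(maximalRealSubfield (L : Type))) (L : Type) t)), 1)
            (piSchwartzBruhatConj (↥(maximalRealSubfield (L : Type))) (Fin 3)
              (testFun (↥(maximalRealSubfield (L : Type))) (Fin 3) (gaussianAt V a') x₀ N))))
    (h : HasCentralTypeAt V a s m) : HasCentralTypeAt V a' s' (-m) :=
  hasCentralTypeAt_neg_of_conj V (piSchwartzBruhatConj_testFun_gaussianAt V a a' ha') hconj h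

end Flip

/-! ## §4 The reading in Liu's table: the conjugate partner is `ι_{μ′}`, `μ′` of weight one with `Φ_{μ′} = Φ^δ(−a)`, at the mirror class -/

section Table

variable {L : CMField} {ι₁ : (L : Type) →+* ℂ} (V : HermSpace3 L ι₁) (ρ : GramClass L → RealScalar L)

/-- **`τ ∈ Φ^δ(−a) ↔ τ ∉ Φ^δ(a)`** (`Im τ(δ_L·(−a)) = −Im τ(δ_L a) = Im τ̄(δ_L a)` and a CM type contains exactly one of `τ, τ̄`); the
type-level form `Φ^δ(−a) = Φ̄^δ(a)` is wb-1's ✔ `D2Bridge/LineTypeConj.bar_lineType`. [cite: Liu2021, Definition 4.12 and Remark 4.4] -/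
theorem mem_lineType_iff_not_mem_of_val_eq_neg (a a' : RealScalar L) (ha' : a'.1 = -a.1) (τ : (L : Type) →+* ℂ) :
    τ ∈ (lineType a'.1 a'.2.1 a'.2.2).1 ↔ τ ∉ (lineType a.1 a.2.1 a.2.2).1 := by
  have h1 : τ ∈ (lineType a'.1 a'.2.1 a'.2.2).1 ↔ conjugate τ ∈ (lineType a.1 a.2.1 a.2.2).1 := by
    rw [mem_lineType_iff, mem_lineType_iff, conjugate_coe_eq, Complex.conj_im, ha', mul_neg, map_neg, Complex.neg_im]
  exact h1.trans (HodgeCM.CMTypeOps.conjugate_mem_iff_notMem _ _)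

variable {ρ} in
/-- **`muLiu ι₁ ρ (mk a') = − muLiu ι₁ ρ (mk a)` for `a' = −a`**: Liu's weight-one table at the MIRROR class is the negative of the
table at the class (`∓𝟙_{w₁} ↦ ±𝟙_{w₁}`: `ι₁` lies in exactly one of `Φ^δ(a)`, `Φ^δ(−a)`). [folklore] -/
theorem muLiu_mk_eq_neg_of_val_eq_neg (hρ : ∀ q, GramClass.mk (ρ q) = q) (a a' : RealScalar L) (ha' : a'.1 = -a.1) :
    muLiu ι₁ ρ (GramClass.mk a') = -muLiu ι₁ ρ (GramClass.mk a) := by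
  have hiff := mem_lineType_iff_not_mem_of_val_eq_neg a a' ha' ι₁
  rw [muLiu_mk hρ a', muLiu_mk hρ a]
  by_cases h : ι₁ ∈ (lineType a.1 a.2.1 a.2.2).1
  · rw [if_pos h, if_neg (fun h' => hiff.1 h' h), neg_neg]
  · rw [if_neg h, if_pos (hiff.2 h)]

variable {ρ} in
/-- **`muLiu ι₁ ρ (mk a) = centralType (weightOneType Φ^δ(a))` AT THE SCALAR `a` ITSELF** (file 2's
`centralType_weightOneType_lineType_eq_muLiu` reads the representative `ρ q`; here any scalar of the class, under E's
`hemb : (mk ι₁).embedding = ι₁`). [folklore] -/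
theorem muLiu_mk_eq_centralType_weightOneType_lineType (hρ : ∀ q, GramClass.mk (ρ q) = q)
    (hemb : (InfinitePlace.mk ι₁).embedding = ι₁) (a : RealScalar L) :
    muLiu ι₁ ρ (GramClass.mk a) =
      centralType (L : Type) e₁ (frameD V) (frameD_real V) (RealScalar.vec a) (RealScalar.vec_real a)
        (weightOneType (L : Type) (lineType a.1 a.2.1 a.2.2)) := by
  have hΦ : ∀ φ : (L : Type) →+* ℂ, φ ∈ (lineType a.1 a.2.1 a.2.2).1 ↔ 0 < (φ (imagUnit (L : Type) * a.1)).im := fun φ => by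
    rw [mem_lineType_iff, eta_eq_imagUnit]
  have hw₁ : (cmPlaceOver (L : Type) (HypCensus.cmPlace (L : Type) ι₁)).1 = InfinitePlace.mk ι₁ :=
    cmPlaceOver_eq_mk (L : Type) _ ι₁ rfl
  rw [centralType_weightOneType_of_deltaPos_of_embedding_eq V a _ hΦ hemb, muLiu_mk hρ a]
  unfold placeIndicator
  rw [hw₁]
  by_cases h : 0 < (ι₁ (imagUnit (L : Type) * a.1)).im
  · rw [if_pos h, if_pos ((hΦ ι₁).2 h)]
  · rw [if_neg h, if_neg (mt (hΦ ι₁).1 h)]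

set_option maxHeartbeats 4000000 in
/-- **(T4d) IN THE TABLE CURRENCY.**  Let `s` be a pair splitting at `a` of Liu's central type `∓𝟙_{mk ι₁}` of `Φ^δ(a)` and `s'` a
CONTINUOUS compatible pair splitting at `a' = −a` whose centre action on the Gaussian test functions is the `C`-conjugate of that of `s`
(`hconj`, the law of the conjugate splitting).  Then `s' = ι_{toHecke μ′}` for some `μ′` conjugate symplectic OF WEIGHT ONE with
`Φ_{μ′} = Φ^δ(−a)` (`= Φ̄^δ(a)`): the flip §3 + ✔ `exists_weightOne_eq_chiSplittingLine_toHeckeCharacter_of_hasCentralTypeAt` at `a'`.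
[cite: Liu2021, Definition 4.12 and Remark 4.4] -/
theorem exists_weightOne_eq_chiSplittingLine_toHeckeCharacter_of_conj (a a' : RealScalar L) (ha' : a'.1 = -a.1)
    (s : SplittingAt V a) (s' : SplittingAt V a') (hsc' : Continuous s') (hs' : IsCompatAtScalar V a' s')
    (hconj : ∀ (t : ↥(Literature.NumberTheory.Automorphic.relNormOneInfUnits (↥(maximalRealSubfield (L : Type))) (L : Type)))
      (x₀ : Fin 3 → ↥(maximalRealSubfield (L : Type))) (N : ℕ),
      pairRep (↥(maximalRealSubfield (L : Type))) (L : Type) (IsCMField.complexConj (L : Type)) 3 1 e₁ (Matrix.diagonal (frameD V))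
          (Matrix.diagonal (RealScalar.vec a')) s'
          (CMCenter (L : Type) (frameD V)
            ((cmAdelicOneEquivRelNormOne (L : Type)).symm
              (Literature.NumberTheory.Automorphic.relNormOneInfToIdeles (↥(maximalRealSubfield (L : Type))) (L : Type) t)), 1)
          (testFun (↥(maximalRealSubfield (L : Type))) (Fin 3) (gaussianAt V a') x₀ N) =
        piSchwartzBruhatConj (↥(maximalRealSubfield (L : Type))) (Fin 3)
          (pairRep (↥(maximalRealSubfield (L : Type))) (L : Type) (IsCMField.complexConj (L : Type)) 3 1 e₁ (Matrix.diagonal (frameD V))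
            (Matrix.diagonal (RealScalar.vec a)) s
            (CMCenter (L : Type) (frameD V)
              ((cmAdelicOneEquivRelNormOne (L : Type)).symm
                (Literature.NumberTheory.Automorphic.relNormOneInfToIdeles (↥(maximalRealSubfield (L : Type))) (L : Type) t)), 1)
            (piSchwartzBruhatConj (↥(maximalRealSubfield (L : Type))) (Fin 3)
              (testFun (↥(maximalRealSubfield (L : Type))) (Fin 3) (gaussianAt V a') x₀ N))))
    (hP : HasCentralTypeAt V a s
      (if (InfinitePlace.mk ι₁).embedding ∈ (lineType a.1 a.2.1 a.2.2).1 then -Pi.single (InfinitePlace.mk ι₁) 1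
        else Pi.single (InfinitePlace.mk ι₁) 1)) :
    ∃ (μ : Literature.NumberTheory.Automorphic.IdeleClassGroup (L : Type) →ₜ* Circle) (hμ : IsConjugateSymplectic (L : Type) μ),
      HasWeight (L : Type) μ 1 ∧ HasCMType (L : Type) μ (lineType a'.1 a'.2.1 a'.2.2) ∧
        s' = chiSplittingLine (L : Type) e₁ (frameD V) (frameD_real V) (frameD_ne V) (toHeckeCharacter (L : Type) μ)
              (isUnitary_toHeckeCharacter (L : Type) μ) (isSplittingChar_toHeckeCharacter_of_isConjugateSymplectic (L : Type) μ hμ)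
              (realDiagonal (L : Type) (RealScalar.vec a') (RealScalar.vec_real a'))
              (isUnit_det_realDiagonal (L : Type) (RealScalar.vec a') (RealScalar.vec_real a') (RealScalar.vec_ne a'))
              (Matrix.diagonal (RealScalar.vec a')) (realDiagonal_map (L : Type) (RealScalar.vec a') (RealScalar.vec_real a')).symm := by
  have hflip := hasCentralTypeAt_neg_of_conj_of_val_eq_neg V ha' hconj hP
  have hiff := mem_lineType_iff_not_mem_of_val_eq_neg a a' ha' (InfinitePlace.mk ι₁).embedding
  have key : HasCentralTypeAt V a' s'
      (if (InfinitePlace.mk ι₁).embedding ∈ (lineType a'.1 a'.2.1 a'.2.2).1 then -Pi.single (InfinitePlace.mk ι₁) 1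
        else Pi.single (InfinitePlace.mk ι₁) 1) := by
    by_cases h : (InfinitePlace.mk ι₁).embedding ∈ (lineType a.1 a.2.1 a.2.2).1
    · rw [if_neg (fun h' => hiff.1 h' h)]
      rw [if_pos h, neg_neg] at hflip
      exact hflip
    · rw [if_pos (hiff.2 h)]
      rw [if_neg h] at hflip
      exact hflip
  have hΦ' : ∀ φ : (L : Type) →+* ℂ, φ ∈ (lineType a'.1 a'.2.1 a'.2.2).1 ↔ 0 < (φ (imagUnit (L : Type) * a'.1)).im := fun φ => by
    rw [mem_lineType_iff, eta_eq_imagUnit]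
  exact exists_weightOne_eq_chiSplittingLine_toHeckeCharacter_of_hasCentralTypeAt V a' _ hΦ' s' hsc' hs' key

set_option maxHeartbeats 4000000 in
/-- **(T4d) IN THE INDEX CURRENCY `muLiu`.**  For a section `ρ` of `mk`, under E's `hemb`: if `s` at `a` has Liu's central type
`muLiu ι₁ ρ (mk a)` of its class (e.g. `s = (line i).s`, `hasCentralTypeAt_of_mem`) and `s'` is a continuous compatible conjugate partner at
`a' = −a` (`hconj`), then `s' = ι_{toHecke μ′}`, `μ′` conjugate symplectic OF WEIGHT ONE with `Φ_{μ′} = Φ^δ(a')`, AND `s'` has Liu's central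
type `muLiu ι₁ ρ (mk a')` of the MIRROR class — i.e. `(mk a', s')` satisfies the membership predicate `CentralTypeIs V (muLiu ι₁ ρ)` of the
index `I V ρ (muLiu ι₁ ρ)` wherever the section hits `a'` (L69 `I.exists_line_eq_ofCM`). [cite: Liu2021, Definition 4.12 and Remark 4.4] -/
theorem exists_weightOne_eq_chiSplittingLine_toHeckeCharacter_of_conj_muLiu (hρ : ∀ q, GramClass.mk (ρ q) = q)
    (hemb : (InfinitePlace.mk ι₁).embedding = ι₁) (a a' : RealScalar L) (ha' : a'.1 = -a.1)
    (s : SplittingAt V a) (s' : SplittingAt V a') (hsc' : Continuous s') (hs' : IsCompatAtScalar V a' s')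
    (hconj : ∀ (t : ↥(Literature.NumberTheory.Automorphic.relNormOneInfUnits (↥(maximalRealSubfield (L : Type))) (L : Type)))
      (x₀ : Fin 3 → ↥(maximalRealSubfield (L : Type))) (N : ℕ),
      pairRep (↥(maximalRealSubfield (L : Type))) (L : Type) (IsCMField.complexConj (L : Type)) 3 1 e₁ (Matrix.diagonal (frameD V))
          (Matrix.diagonal (RealScalar.vec a')) s'
          (CMCenter (L : Type) (frameD V)
            ((cmAdelicOneEquivRelNormOne (L : Type)).symm
              (Literature.NumberTheory.Automorphic.relNormOneInfToIdeles (↥(maximalRealSubfield (L : Type))) (L : Type) t)), 1)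
          (testFun (↥(maximalRealSubfield (L : Type))) (Fin 3) (gaussianAt V a') x₀ N) =
        piSchwartzBruhatConj (↥(maximalRealSubfield (L : Type))) (Fin 3)
          (pairRep (↥(maximalRealSubfield (L : Type))) (L : Type) (IsCMField.complexConj (L : Type)) 3 1 e₁ (Matrix.diagonal (frameD V))
            (Matrix.diagonal (RealScalar.vec a)) s
            (CMCenter (L : Type) (frameD V)
              ((cmAdelicOneEquivRelNormOne (L : Type)).symm
                (Literature.NumberTheory.Automorphic.relNormOneInfToIdeles (↥(maximalRealSubfield (L : Type))) (L : Type) t)), 1)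
            (piSchwartzBruhatConj (↥(maximalRealSubfield (L : Type))) (Fin 3)
              (testFun (↥(maximalRealSubfield (L : Type))) (Fin 3) (gaussianAt V a') x₀ N))))
    (hP : HasCentralTypeAt V a s (muLiu ι₁ ρ (GramClass.mk a))) :
    (∃ (μ : Literature.NumberTheory.Automorphic.IdeleClassGroup (L : Type) →ₜ* Circle) (hμ : IsConjugateSymplectic (L : Type) μ),
      HasWeight (L : Type) μ 1 ∧ HasCMType (L : Type) μ (lineType a'.1 a'.2.1 a'.2.2) ∧
        s' = chiSplittingLine (L : Type) e₁ (frameD V) (frameD_real V) (frameD_ne V) (toHeckeCharacter (L : Type) μ)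
              (isUnitary_toHeckeCharacter (L : Type) μ) (isSplittingChar_toHeckeCharacter_of_isConjugateSymplectic (L : Type) μ hμ)
              (realDiagonal (L : Type) (RealScalar.vec a') (RealScalar.vec_real a'))
              (isUnit_det_realDiagonal (L : Type) (RealScalar.vec a') (RealScalar.vec_real a') (RealScalar.vec_ne a'))
              (Matrix.diagonal (RealScalar.vec a')) (realDiagonal_map (L : Type) (RealScalar.vec a') (RealScalar.vec_real a')).symm) ∧
      HasCentralTypeAt V a' s' (muLiu ι₁ ρ (GramClass.mk a')) := by
  have hflip := hasCentralTypeAt_neg_of_conj_of_val_eq_neg V ha' hconj hP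
  rw [← muLiu_mk_eq_neg_of_val_eq_neg hρ a a' ha'] at hflip
  refine ⟨?_, hflip⟩
  rw [muLiu_mk_eq_centralType_weightOneType_lineType V hρ hemb a'] at hflip
  exact exists_weightOne_eq_chiSplittingLine_toHeckeCharacter_of_hasCentralTypeAt_weightOneType V a' _ s' hsc' hs' hflip

variable {ρ} in
set_option maxHeartbeats 4000000 in
/-- **(T4d) FOR AN INDEX LINE.**  For an index `i : I V ρ (muLiu ι₁ ρ')` (positions `ρ`, types by a section `ρ'` of `mk`, under E's `hemb`)
and a continuous compatible conjugate partner `s'` of its pair splitting `i.2.1` at `a' = −(ρ i.1)` (`hconj`): `s' = ι_{toHecke μ′}`, `μ′`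
conjugate symplectic OF WEIGHT ONE with `Φ_{μ′} = Φ^δ(a')`, and `s'` has Liu's central type `muLiu ι₁ ρ' (mk a')` of the mirror class —
the typing predicate of the same index family at `mk a'`. [cite: Liu2021, Definition 4.12 and Remark 4.4] -/
theorem exists_weightOne_eq_chiSplittingLine_toHeckeCharacter_of_conj_line (ρ' : GramClass L → RealScalar L)
    (hρ' : ∀ q, GramClass.mk (ρ' q) = q) (hemb : (InfinitePlace.mk ι₁).embedding = ι₁) (i : I V ρ (muLiu ι₁ ρ'))
    (a' : RealScalar L) (ha' : a'.1 = -(ρ i.1).1) (s' : SplittingAt V a') (hsc' : Continuous s') (hs' : IsCompatAtScalar V a' s')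
    (hconj : ∀ (t : ↥(Literature.NumberTheory.Automorphic.relNormOneInfUnits (↥(maximalRealSubfield (L : Type))) (L : Type)))
      (x₀ : Fin 3 → ↥(maximalRealSubfield (L : Type))) (N : ℕ),
      pairRep (↥(maximalRealSubfield (L : Type))) (L : Type) (IsCMField.complexConj (L : Type)) 3 1 e₁ (Matrix.diagonal (frameD V))
          (Matrix.diagonal (RealScalar.vec a')) s'
          (CMCenter (L : Type) (frameD V)
            ((cmAdelicOneEquivRelNormOne (L : Type)).symm
              (Literature.NumberTheory.Automorphic.relNormOneInfToIdeles (↥(maximalRealSubfield (L : Type))) (L : Type) t)), 1)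
          (testFun (↥(maximalRealSubfield (L : Type))) (Fin 3) (gaussianAt V a') x₀ N) =
        piSchwartzBruhatConj (↥(maximalRealSubfield (L : Type))) (Fin 3)
          (pairRep (↥(maximalRealSubfield (L : Type))) (L : Type) (IsCMField.complexConj (L : Type)) 3 1 e₁ (Matrix.diagonal (frameD V))
            (Matrix.diagonal (RealScalar.vec (ρ i.1))) i.2.1
            (CMCenter (L : Type) (frameD V)
              ((cmAdelicOneEquivRelNormOne (L : Type)).symm
                (Literature.NumberTheory.Automorphic.relNormOneInfToIdeles (↥(maximalRealSubfield (L : Type))) (L : Type) t)), 1)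
            (piSchwartzBruhatConj (↥(maximalRealSubfield (L : Type))) (Fin 3)
              (testFun (↥(maximalRealSubfield (L : Type))) (Fin 3) (gaussianAt V a') x₀ N)))) :
    (∃ (μ : Literature.NumberTheory.Automorphic.IdeleClassGroup (L : Type) →ₜ* Circle) (hμ : IsConjugateSymplectic (L : Type) μ),
      HasWeight (L : Type) μ 1 ∧ HasCMType (L : Type) μ (lineType a'.1 a'.2.1 a'.2.2) ∧
        s' = chiSplittingLine (L : Type) e₁ (frameD V) (frameD_real V) (frameD_ne V) (toHeckeCharacter (L : Type) μ)
              (isUnitary_toHeckeCharacter (L : Type) μ) (isSplittingChar_toHeckeCharacter_of_isConjugateSymplectic (L : Type) μ hμ)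
              (realDiagonal (L : Type) (RealScalar.vec a') (RealScalar.vec_real a'))
              (isUnit_det_realDiagonal (L : Type) (RealScalar.vec a') (RealScalar.vec_real a') (RealScalar.vec_ne a'))
              (Matrix.diagonal (RealScalar.vec a')) (realDiagonal_map (L : Type) (RealScalar.vec a') (RealScalar.vec_real a')).symm) ∧
      HasCentralTypeAt V a' s' (muLiu ι₁ ρ' (GramClass.mk a')) :=
  exists_weightOne_eq_chiSplittingLine_toHeckeCharacter_of_conj_muLiu V ρ' hρ' hemb (ρ i.1) a' ha' i.2.1 s' hsc' hs' hconj
    (hasCentralTypeAt_of_mem V ρ (muLiu ι₁ ρ') i)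

end Table

end Summit.HodgeConjecture.CorCM.Transposition.CentralTypeAtPin

end
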